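import Summits.Ventures.HSemireg.Pad4TowerTorusBlindBase


/-!
# Venture HSemireg — PAD-4 on 𝔅(μ₄): LEMMA T — TORUS BLINDNESS OF THE STATIC GAME, part 2∕2: X, A2I, the diamond, the theorem (gs-eng-2 g53)

HONEST FRAMING. Lean index of the computation cell `pub-hsemireg` (S4-PUSH, H2 door PAD-4, line stmt-HodgeConjecture-18881), written by the
cell's second-code engine `gs-eng-2` (g53). Census-neutral: a theorem ABOUT THE TYPED STATIC PREDICATES of record (`RuleDMu4Closed` of
`Pad4TowerRuleDMu4`; `XMinusClosed`, `XPlusClosed`, `A2IMinusClosed`, `A2IPlusClosed` of `Pad4TowerXresFamilies`; `InDiamond` of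
`Pad4TowerDiamondMu4`; `StaticH1` of `Pad4TowerSeedB1`); nothing here is an object, a σ, a seed or a census row; NOTHING HERE SAYS THAT HC ∕ HC_CM ∕
HC_AV ∕ H2 HOLDS OR FAILS. No `sorry`, no `axiom`, no `instance`, no notation, no Literature fact.

WHAT. The torus `(ℤ∕4)⁴` acts on 𝔅(μ₄) cells factorwise by quarter-turn phase rotations (`Pad4TowerPhaseTorus.MCell.phase η`,
`(η·Z)_f = rot^{η_f}(Z_f)`, `rot(α, β) = (α, iβ)`), and on two-level configurations by rotating every cell of both levels
(`MConfig.phaseImage η`). **THEOREM (`staticFamilies_torusInvariant_familywise`): for EVERY `η` — partial moves (rotating one factor only)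
included — and every configuration `C`, each of `RuleDMu4Closed`, `XMinusClosed`, `XPlusClosed`, `A2IMinusClosed`, `A2IPlusClosed` holds on
`C.phaseImage η` iff it holds on `C`, and so does every `InDiamond h`;** hence `StaticH1` (`staticH1_phaseImage`). PROOF: every one of these
predicates is a first-order combination of per-factor primitives (`ray`, `UPartner`, `Sibling`, `MAgree(2)`, `NullBelow`, `Effective ∕
Timelike ∕ Spacelike` of same-factor differences, `isApex`, `coord`, `Adapted`, `DirOK`, `EncDir`, `OnULineBelowEq`, `cabs`, `AxisPt`) in
which every DIRECTION variable is attached to one factor and is quantified inside the predicate; rotating factor `f` by `n` quarter turns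
carries direction `k` to `dsh n k = k + 3n` (`phasePt_ray`), fixes `α`, `cabs`, `isApex` and the causal type of same-factor differences, and
re-indexes the direction quantifiers bijectively (`forall_dsh` ∕ `exists_dsh`); the only cross-factor comparisons (RULE D's coordinate VALUES)
are shift-covariant (`coord_phasePt`). The dual of `Pad4TowerRuleDMu4Dual` commutes with the rotation (`dual_phaseImage`), which transports
the X⁻ ∕ A2I⁻ statements to X⁺ ∕ A2I⁺. This is bc5-plan g8 ∕ typer-2 g6's hypothesis-form `StaticFamiliesTorusInvariantFamilywise` ((T′-a)
`Pad4TowerStaticTorus`, not yet in the tree at the time of writing), PROVED here (`staticFamilies_torusInvariant_familywise`) and packaged as their `def`s: `staticFamiliesTorusInvariantFamilywise_holds`, `staticFamiliesTorusInvariant_holds`, whence (σ-N) needs only the witness support (`not_seedB1OddDiamond8DeltaH1_of_witness`).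

WHY IT MATTERS (note `general-structure∕PENCIL-B1ODD-gs2g53.md` §1, director-hodge R14.6 (3) ∕ R14.15): the static game of LINE 5 is
`(ℤ∕4) ≀ S₄`-symmetric; the torus acts TRANSITIVELY on the 16 phase-bit patterns while `FCc`, `InDiamond 8` and `Δ`-closure (Δ is central) are
torus-invariant — so the ONLY input of the seed (T) `SeedB1OddDiamond8G1H1` that can distinguish an odd-weight FC class from an even one is the
`S₄`-closure half of `G1Closed`; `Δ`-closure + statics alone are parity-blind (typer-2's (σ-N) `not_seedB1OddDiamond8DeltaH1_of` takes this
theorem as its first hypothesis). Machine cross-check before the proof: `gs2∕g53∕pad4∕valtorus.py` (300 random instance-centred supports × 6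
families, 0 failures).

SOURCES: `Pad4TowerPhaseTorus.lean` ((H): `PVec`, `phasePt`, `MCell.phase`, `MCell.phase_injective`), `Pad4TowerRuleDMu4.lean`,
`Pad4TowerRuleDMu4Dual.lean` (`dualPt`, `dualCell`, `MConfig.dual`), `Pad4TowerXStaticSafe2.lean` + `Pad4TowerXresFamilies.lean` (X ∕ A2I
families), `Pad4TowerDiamondMu4.lean`, `Pad4TowerSeedB1.lean` (`StaticH1`); cell INBOX l.32657 (3), l.32658 R14.6 (3), bc5-plan g8 sketch
`SketchStaticTorus.lean` v3 bfdd78d090f0d634 ∕ typer-2 g6 staging `Pad4TowerStaticTorus.lean` v3 49126969d7678ba9 (the hypothesis-form statement). -/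

namespace Summit.Ventures.HSemireg.Pad4Tower

open Finset

/-! ## §5 The X family is torus-blind -/

section XFamily

variable (η : PVec) (C : MConfig)

/-- the ray relation on one factor, rotated: `y` is `e` steps of direction `k` above `x`. -/
theorem phasePt_eq_ray_iff (n : Fin 4) (x y : BPoint) (k : Fin 4) (e : ℤ) :
    phasePt n y = ray (phasePt n x) (dsh n k) e ↔ y = ray x k e := by
  rw [← phasePt_ray]; exact (phasePt_injective n).eq_iff

/-- torus covariance: `sibling_phase`. -/
theorem sibling_phase (q n : MCell) (σ w : Fin 4) :
    Sibling (q.phase η) (n.phase η) σ (dsh (η σ) w) ↔ Sibling q n σ w := by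
  simp only [Sibling, magree_phase, phase_apply, phasePt_fst]
  constructor
  · rintro ⟨h1, h2, h3⟩
    refine ⟨h1, h2, phasePt_injective (η σ) ?_⟩
    rw [h3, phasePt_ray]
  · rintro ⟨h1, h2, h3⟩
    refine ⟨h1, h2, ?_⟩
    rw [h3, phasePt_ray, ← h3]

/-- torus covariance: `noCompanion_phase`. -/
theorem noCompanion_phase (q n : MCell) (σ w : Fin 4) :
    NoCompanion (C.phaseImage η) (q.phase η) (n.phase η) σ (dsh (η σ) w) ↔ NoCompanion C q n σ w := by
  simp only [NoCompanion, forall_phaseImage_upper, magree_phase, phase_apply, phasePt_fst, ne_eq, phasePt_eq_ray_iff]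

/-- torus covariance: `heOkP_phase`. -/
theorem heOkP_phase (Z q n : MCell) (σ : Fin 4) :
    HeOkP (C.phaseImage η) (Z.phase η) (q.phase η) (n.phase η) σ ↔ HeOkP C Z q n σ := by
  simp only [HeOkP, forall_phaseImage_upper, magree_phase, phase_apply, ne_eq, (phasePt_injective _).eq_iff, bsub_phasePt,
    effective_phasePt, timelike_phasePt]

/-- torus covariance: `hbOkP_phase`. -/
theorem hbOkP_phase (Z n : MCell) (σ f : Fin 4) :
    HbOkP (C.phaseImage η) (Z.phase η) (n.phase η) σ f ↔ HbOkP C Z n σ f := by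
  simp only [HbOkP, forall_phaseImage_upper, magree2_phase, phase_apply, nullBelow_phasePt, bsub_phasePt, effective_phasePt,
    timelike_phasePt]

/-- torus covariance: `wfEmpty_phase`. -/
theorem wfEmpty_phase (Z : MCell) (f : Fin 4) : WfEmpty (C.phaseImage η) (Z.phase η) f ↔ WfEmpty C Z f := by
  simp only [WfEmpty, forall_phaseImage_upper, magree_phase, magree2_phase, phase_apply, nullBelow_phasePt]

/-- one X instance, rotated (partner direction `u` and sibling direction `w` shift with the factor `σ`). -/
theorem xresXFires_phase (Z q n : MCell) (σ u w f : Fin 4) :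
    XresXFires (C.phaseImage η) (Z.phase η) (q.phase η) (n.phase η) σ (dsh (η σ) u) (dsh (η σ) w) f ↔
      XresXFires C Z q n σ u w f := by
  simp only [XresXFires, uPartner_phase, sibling_phase, noCompanion_phase, heOkP_phase, hbOkP_phase, wfEmpty_phase,
    forall_phaseImage_upper, ne_eq, (dsh_injective _).eq_iff, phase_apply, isApex_phasePt, phasePt_fst]

/-- **the X family (X⁻ reading: heads at level `N`) is torus-blind.** -/
theorem xresXClosed_phaseImage : XresXClosed (C.phaseImage η) ↔ XresXClosed C := by
  simp only [XresXClosed, forall_phaseImage_lower, forall_phaseImage_upper]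
  refine forall_congr' fun Z => forall_congr' fun _ => forall_congr' fun q => forall_congr' fun _ =>
    forall_congr' fun n => forall_congr' fun _ => forall_congr' fun σ => ?_
  rw [← forall_dsh (η σ)]
  refine forall_congr' fun u => ?_
  rw [← forall_dsh (η σ)]
  refine forall_congr' fun w => forall_congr' fun f => ?_
  rw [xresXFires_phase]

/-- **X⁻ is torus-blind.** -/
theorem xMinusClosed_phaseImage : XMinusClosed (C.phaseImage η) ↔ XMinusClosed C := xresXClosed_phaseImage η C

/-- the dual commutes with the phase rotation, pointwise … -/
theorem dualPt_phasePt (n : Fin 4) (x : BPoint) : dualPt 0 (phasePt n x) = phasePt n (dualPt 0 x) := by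
  obtain ⟨a, b, c⟩ := x; fin_cases n <;> simp [dualPt, phasePt]

/-- … on cells … -/
theorem dualCell_phase (Z : MCell) : dualCell 0 (Z.phase η) = (dualCell 0 Z).phase η := by
  funext f; simp [dualCell, phase_apply, dualPt_phasePt]

/-- … and on configurations. -/
theorem dual_phaseImage : (C.phaseImage η).dual 0 = (C.dual 0).phaseImage η := by
  simp only [MConfig.dual, MConfig.phaseImage, Finset.image_image, MConfig.mk.injEq]
  constructor <;> (congr 1; funext X; exact dualCell_phase η X)

/-- **X⁺ (the dual reading) is torus-blind.** -/
theorem xPlusClosed_phaseImage : XPlusClosed (C.phaseImage η) ↔ XPlusClosed C := by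
  rw [XPlusClosed, dual_phaseImage, xresXClosed_phaseImage]

end XFamily

/-! ## §6 The A2I family is torus-blind -/

section A2IFamily

variable (η : PVec) (C : MConfig)

/-- apex points are fixed by every rotation. -/
theorem phasePt_apex (n : Fin 4) (a : ℤ) : phasePt n (a, 0, 0) = (a, 0, 0) := by
  fin_cases n <;> simp [phasePt]

/-- the encoder's own-ray direction follows the shift. -/
theorem encDir_phasePt (n : Fin 4) (x : BPoint) (u : Fin 4) : EncDir (phasePt n x) (dsh n u) ↔ EncDir x u := by
  have key : ∀ a c, (phasePt n x = ray (a, 0, 0) (dsh n u) c) ↔ (x = ray (a, 0, 0) u c) := fun a c => by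
    have := phasePt_eq_ray_iff n (a, 0, 0) x u c
    rwa [phasePt_apex] at this
  simp only [EncDir, phasePt_fst, cabs_phasePt, key]

/-- «on the `u`-line at or below» follows the shift. -/
theorem onULineBelowEq_phasePt (n : Fin 4) (x y : BPoint) (u : Fin 4) :
    OnULineBelowEq (phasePt n x) (phasePt n y) (dsh n u) ↔ OnULineBelowEq x y u := by
  simp only [OnULineBelowEq, phasePt_fst, phasePt_eq_ray_iff]

/-- one A2I instance, rotated (own direction `u` shifts with `σ`, server direction `v` with `f′`). -/
theorem xresA2IFires_phase (Z q N' : MCell) (σ u f' v : Fin 4) :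
    XresA2IFires (C.phaseImage η) (Z.phase η) (q.phase η) (N'.phase η) σ (dsh (η σ) u) f' (dsh (η f') v) ↔
      XresA2IFires C Z q N' σ u f' v := by
  simp only [XresA2IFires, uPartner_phase, forall_phaseImage_upper, magree_phase, magree2_phase, phase_apply, isApex_phasePt,
    phasePt_fst, cabs_phasePt, encDir_phasePt, nullBelow_phasePt, bsub_phasePt, effective_phasePt, spacelike_phasePt,
    onULineBelowEq_phasePt, phasePt_eq_ray_iff, (phasePt_injective _).eq_iff, ne_eq]
  refine and_congr_right fun _ => and_congr_right fun _ => and_congr_right fun _ => and_congr_right fun _ =>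
    and_congr_right fun _ => and_congr_right fun _ => ?_
  refine and_congr ?_ Iff.rfl
  refine forall_congr' fun P => forall_congr' fun _ => ?_
  rw [← forall_dsh (η σ)]
  simp only [(dsh_injective _).eq_iff, uPartner_phase]

/-- **the A2I family (A2I⁻ reading: heads at level `N`) is torus-blind.** -/
theorem xresA2IClosed_phaseImage : XresA2IClosed (C.phaseImage η) ↔ XresA2IClosed C := by
  simp only [XresA2IClosed, forall_phaseImage_lower, forall_phaseImage_upper]
  refine forall_congr' fun Z => forall_congr' fun _ => forall_congr' fun q => forall_congr' fun _ =>
    forall_congr' fun N' => forall_congr' fun _ => forall_congr' fun σ => ?_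
  rw [← forall_dsh (η σ)]
  refine forall_congr' fun u => forall_congr' fun f' => ?_
  rw [← forall_dsh (η f')]
  refine forall_congr' fun v => ?_
  rw [xresA2IFires_phase]

/-- **A2I⁻ is torus-blind.** -/
theorem a2iMinusClosed_phaseImage : A2IMinusClosed (C.phaseImage η) ↔ A2IMinusClosed C := xresA2IClosed_phaseImage η C

/-- **A2I⁺ (the dual reading) is torus-blind.** -/
theorem a2iPlusClosed_phaseImage : A2IPlusClosed (C.phaseImage η) ↔ A2IPlusClosed C := by
  rw [A2IPlusClosed, dual_phaseImage, xresA2IClosed_phaseImage]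

end A2IFamily

/-! ## §7 The diamond, and LEMMA T assembled -/

/-- «β on an axis or zero» is rotation-invariant. -/
theorem axisOrZero_phasePt (n : Fin 4) (x : BPoint) :
    ((phasePt n x).2 = (0, 0) ∨ AxisPt (phasePt n x)) ↔ (x.2 = (0, 0) ∨ AxisPt x) := by
  obtain ⟨a, b, c⟩ := x
  fin_cases n <;> simp [phasePt, AxisPt] <;> tauto

/-- the absolute charge of an axis letter is rotation-invariant. -/
theorem absCharge_phasePt (n : Fin 4) {x : BPoint} (hx : x.2 = (0, 0) ∨ AxisPt x) : absCharge (phasePt n x) = absCharge x := by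
  obtain ⟨a, b, c⟩ := x
  simp only [AxisPt, Prod.mk.injEq] at hx
  rcases hx with ⟨rfl, rfl⟩ | ⟨-, rfl⟩ | ⟨rfl, -⟩ <;> fin_cases n <;> simp [phasePt, absCharge, chargeOf, abs_neg]

/-- the diamond universe ◇_h is rotation-invariant, letter by letter … -/
theorem inDiamond_phasePt (n : Fin 4) (h : ℤ) (x : BPoint) : InDiamond h (phasePt n x) ↔ InDiamond h x := by
  simp only [InDiamond]
  rw [axisOrZero_phasePt, phasePt_fst]
  constructor
  · rintro ⟨hax, h2, h3, h4⟩
    rw [absCharge_phasePt n hax] at h2 h3 h4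
    exact ⟨hax, h2, h3, h4⟩
  · rintro ⟨hax, h2, h3, h4⟩
    rw [← absCharge_phasePt n hax] at h2 h3 h4
    exact ⟨hax, h2, h3, h4⟩

/-- … and configuration by configuration. -/
theorem inDiamond_phaseImage (η : PVec) (C : MConfig) (h : ℤ) : (C.phaseImage η).InDiamond h ↔ C.InDiamond h := by
  simp only [MConfig.InDiamond, forall_phaseImage_lower, forall_phaseImage_upper, MCell.InDiamond, phase_apply, inDiamond_phasePt]

/-- **LEMMA T (torus blindness of the static game), family-wise and unguarded:** for EVERY phase vector `η ∈ (ℤ∕4)⁴` — partial moves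
included — and every two-level configuration, each static family of record and every diamond universe is invariant under the factorwise
phase rotation. (= bc5-plan g8 ∕ typer-2's hypothesis-form `StaticFamiliesTorusInvariantFamilywise`, here PROVED.) -/
theorem staticFamilies_torusInvariant_familywise (η : PVec) (C : MConfig) :
    (RuleDMu4Closed (C.phaseImage η) ↔ RuleDMu4Closed C) ∧ (XMinusClosed (C.phaseImage η) ↔ XMinusClosed C) ∧
    (XPlusClosed (C.phaseImage η) ↔ XPlusClosed C) ∧ (A2IMinusClosed (C.phaseImage η) ↔ A2IMinusClosed C) ∧
    (A2IPlusClosed (C.phaseImage η) ↔ A2IPlusClosed C) ∧ ∀ h : ℤ, (C.phaseImage η).InDiamond h ↔ C.InDiamond h :=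
  ⟨ruleDMu4Closed_phaseImage η C, xMinusClosed_phaseImage η C, xPlusClosed_phaseImage η C, a2iMinusClosed_phaseImage η C,
    a2iPlusClosed_phaseImage η C, inDiamond_phaseImage η C⟩

/-- **(σ-T′) DISCHARGED**: typer-2's hypothesis-form `StaticFamiliesTorusInvariantFamilywise` (`Pad4TowerStaticTorus`) holds. -/
theorem staticFamiliesTorusInvariantFamilywise_holds : StaticFamiliesTorusInvariantFamilywise :=
  fun η C => staticFamilies_torusInvariant_familywise η C

/-- **(σ-T) DISCHARGED**: the bundle form `StaticFamiliesTorusInvariant` holds. -/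
theorem staticFamiliesTorusInvariant_holds : StaticFamiliesTorusInvariant :=
  staticFamiliesTorusInvariant_of_familywise staticFamiliesTorusInvariantFamilywise_holds

/-- hence (σ-N) unconditionally in its first hypothesis: ONE `H₁`-static `Δ`-closed ◇₈ support with a real-phase FC class refutes the
`Δ`-only weakening of (T) (`Pad4TowerStaticTorus.not_seedB1OddDiamond8DeltaH1_of`). -/
theorem not_seedB1OddDiamond8DeltaH1_of_witness (hW : StaticDeltaSupportWithRealFC) : ¬ SeedB1OddDiamond8DeltaH1 :=
  not_seedB1OddDiamond8DeltaH1_of staticFamiliesTorusInvariant_holds hW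

/-- the bundle form: ◇_h and `StaticH1` are kept by every phase rotation. -/
theorem staticH1_phaseImage (η : PVec) (C : MConfig) : (C.phaseImage η).StaticH1 ↔ C.StaticH1 := by
  simp only [MConfig.StaticH1, ruleDMu4Closed_phaseImage, xPlusClosed_phaseImage, a2iMinusClosed_phaseImage]

end Summit.Ventures.HSemireg.Pad4Tower
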